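import Summits.HodgeConjecture.HodgeConjecture.Theorems.K2E1ChiScatteringEulerQuotientU2     -- ★ p861868 (K2E1-p10, J2 (b)): `exists_analyticAt_eventuallyEq_qc_of_ne{,_one}`, `tendsto_sub_one_mul_qc` (mod the one-source letter `hsrc`)
import HarnessLib

/-!
# K2·E1 ∕ R90·S8 — `K2E1ChiScatteringPoleDichotomyU2`: THE POLE DICHOTOMY OF THE `χ`-SCATTERING COEFFICIENT OF `U(J₂)` ON `{½ < Re}` —
# a NON-ZERO residue `ρ` of `qc` at `z₀` forces `z₀ = 1` AND `χ₀ = 1` («a top-pole residue atom ⇒ `χ₀ = 1`»), modulo the one-source letter `hsrc`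

Track B ∕ K2-LIT, crux h413 = `stmt-HodgeConjecture-24833`, route of record `HCCMUnconditional`; cell `hodgecm-mathlib`, R90-TF section S8 «ContSpec-n½» (R90-CS-plan (g2) ruling S8-R17 (3)
2026-09-04T16:41:27Z → K2E2-p12 (g8): «(β2) POLE DICHOTOMY in LAYER 2's pole currency over ★ J2 §3, `hsrc` a named letter» — a named input of the #4′ LAYER 2 assembly
`R90S8ResHLeClosureCharLinesOfLetters` (K2E1-p15 (g3))).  THEOREMS ONLY (no `def`, no `instance`, no notation, no named-fact hypothesis, no `sorry`; default heartbeats); lane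
`--supports stmt-HodgeConjecture-24833 --as helper` (count-neutral).

THE MATHEMATICS ([Rogawski1990, §13.9 (i) p. 229]; [MoeglinWaldspurger1995, IV.1.11]; [Langlands1976, §7]).  ★ J2 (b) `K2E1ChiScatteringEulerQuotientU2` §3 proves, for one coordinate
`(q, qc, P)` of a continued `χ`-scattering package of `U(J₂)` with the one-source tube factorisation `q = A·L^S(2z−1, ε)∕L^S(2z, ε)` (`ε = χ₀`, the letter `hsrc`), that `qc` extends
analytically across EVERY `z₀ ≠ 1` with `½ < Re z₀`, and across `z₀ = 1` as well when `ε ≠ 1`.  A function that agrees near `z₀` (punctured) with a function analytic at `z₀` has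
residue-limit `(z − z₀)·qc(z) → 0` (§1, generic).  Hence THE DICHOTOMY (§2): if `(z − z₀)·qc(z) → ρ` along `𝓝[≠] z₀` with `ρ ≠ 0` and `½ < Re z₀`, then `z₀ = 1` and `ε = 1`; at `z₀ = 1`
the residue is `ρ = A(1)·G(1)` (★ `tendsto_sub_one_mul_qc`).  §3 reads this in the POLE CURRENCY of the self-dual block package (★ p860865 `exists_linearIsometry_chiSection_selfDual_m1_cm_two`:
`Sp : Finset ℝ`, `hSp : ∀ c ∈ Sp, ½ < c ∧ c < σ₀`, `ρ : ℝ → ℂ`, `hr : ∀ c ∈ Sp, Tendsto (fun z => (z − c)·s z) (𝓝[≠] c) (𝓝 (ρ c))` with `s := qc`): every pole `c ∈ Sp` with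
`ρ c ≠ 0` is `c = 1`, and then `χ₀ = 1` — so a residue ATOM of non-zero weight of a self-dual `χ`-block sits at the top pole and forces `χ₀ = 1` (the (β2) input of letter (L): with
★ p861962∕p862022 such an atom lies in `⨆_ψ ℂ·[ψ∘det]`).  §4: the CM print `F = L⁺`.
HONEST LABEL: HC_CM is proved only modulo the 7 printed citations (2 remaining named inputs: hLiu418 = `stmt-HodgeConjecture-24832`, h413 = `stmt-HodgeConjecture-24833`) until rung 0
closes; count-neutral helper; closes no socket; every §2–§4 statement carries ★ J2's letters (`hε hA1 hS hur`, the package clauses `hqcq hPcd hqa`, `A hA`, and `hsrc`) VISIBLY.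

## References
* [Rogawski1990] J. D. Rogawski, *Automorphic Representations of Unitary Groups in Three Variables* (1990), §13.9 (i) p. 229.
* [MoeglinWaldspurger1995] C. Mœglin, J.-L. Waldspurger, *Spectral Decomposition and Eisenstein Series* (1995), IV.1.11.
* [Langlands1976] R. P. Langlands, *On the Functional Equations Satisfied by Eisenstein Series*, LNM 544 (1976), §7.
-/

set_option autoImplicit false
set_option linter.dupNamespace false

noncomputable section

open scoped NNReal
open Set Filter Topology Complex NumberField IsDedekindDomain
open Literature.NumberTheory.Automorphic Literature.NumberTheory.LFunctions Literature.NumberTheory.GaloisRepresentations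
open Summit.HodgeConjecture.HodgeConjecture.Cruxes.H413.K2E1ChiScatteringEulerQuotientU2
  (exists_analyticAt_eventuallyEq_qc_of_ne exists_analyticAt_eventuallyEq_qc_of_ne_one tendsto_sub_one_mul_qc)

namespace Summit.HodgeConjecture.HodgeConjecture.Cruxes.H413.K2E1ChiScatteringPoleDichotomyU2

/-! ## §1 Generic: a removable singularity has residue-limit `0` -/

section Generic

/-- **`(z − z₀)·f(z) → 0`** along `𝓝[≠] z₀` when `f` agrees on a punctured neighbourhood of `z₀` with a function analytic at `z₀`. [cite: Langlands1976, §7] -/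
theorem tendsto_sub_mul_zero_of_eventuallyEq_analyticAt {f g : ℂ → ℂ} {z₀ : ℂ} (hg : AnalyticAt ℂ g z₀) (hfg : f =ᶠ[𝓝[≠] z₀] g) :
    Tendsto (fun z => (z - z₀) * f z) (𝓝[≠] z₀) (𝓝 0) := by
  have hcont : Tendsto (fun z => (z - z₀) * g z) (𝓝[≠] z₀) (𝓝 0) := by
    have h : ContinuousAt (fun z => (z - z₀) * g z) z₀ := (continuousAt_id.sub continuousAt_const).mul hg.continuousAt
    have h2 : Tendsto (fun z => (z - z₀) * g z) (𝓝 z₀) (𝓝 ((z₀ - z₀) * g z₀)) := h.tendsto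
    rw [sub_self, zero_mul] at h2
    exact tendsto_nhdsWithin_of_tendsto_nhds h2
  exact hcont.congr' (hfg.symm.mono fun z hz => by rw [hz])

/-- **A removable singularity has residue `0`**: if moreover `(z − z₀)·f(z) → ρ`, then `ρ = 0`. [cite: Langlands1976, §7] -/
theorem eq_zero_of_tendsto_sub_mul_of_eventuallyEq_analyticAt {f g : ℂ → ℂ} {z₀ ρ : ℂ} (hg : AnalyticAt ℂ g z₀) (hfg : f =ᶠ[𝓝[≠] z₀] g)
    (hρ : Tendsto (fun z => (z - z₀) * f z) (𝓝[≠] z₀) (𝓝 ρ)) : ρ = 0 :=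
  tendsto_nhds_unique hρ (tendsto_sub_mul_zero_of_eventuallyEq_analyticAt hg hfg)

end Generic

/-! ## §2 The dichotomy in ★ J2's currency (one coordinate `(q, qc, P)`, `ε = χ₀`, the one-source letter `hsrc`) -/

section Scattering

variable {F : Type} [Field F] [NumberField F] {ε : HeckeCharacter F} {S : Set (HeightOneSpectrum (𝓞 F))}

/-- **NO RESIDUE OFF `z₀ = 1`**: under ★ J2's hypotheses, a residue-limit `(z − z₀)·qc z → ρ` at `z₀ ≠ 1`, `½ < Re z₀`, has `ρ = 0` (★ `exists_analyticAt_eventuallyEq_qc_of_ne` + §1).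
[cite: Rogawski1990, §13.9 (i) p. 229] [cite: MoeglinWaldspurger1995, IV.1.11] -/
theorem residue_eq_zero_of_ne_one (hε : ε.IsUnitary) (hA1 : ∀ t : ℝ≥0ˣ, ε (posRealIdele F t) = 1) (hS : S.Finite) (hur : ∀ v ∉ S, ε.IsUnramifiedAt v)
    (q qc : ℂ → ℂ) {P : Set ℂ} (hqcq : ∀ z : ℂ, 1 < z.re → qc z = q z) (hPcd : ∀ z₀ : ℂ, ∀ᶠ s in 𝓝[≠] z₀, s ∉ P) (hqa : ∀ z : ℂ, z ∉ P → AnalyticAt ℂ qc z)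
    (A : ℂ → ℂ) (hA : DifferentiableOn ℂ A {z : ℂ | 1 / 2 < z.re})
    (hsrc : ∀ z : ℂ, 1 < z.re →
      q z = A z * (partialStandardL S (fun v => {ε.valueAtUniformizer v}) (2 * z - 1) / partialStandardL S (fun v => {ε.valueAtUniformizer v}) (2 * z)))
    {z₀ : ℂ} (hz₀ : 1 / 2 < z₀.re) (hz₁ : z₀ ≠ 1) {ρ : ℂ} (hρ : Tendsto (fun z : ℂ => (z - z₀) * qc z) (𝓝[≠] z₀) (𝓝 ρ)) : ρ = 0 := by
  obtain ⟨g, hg, hfg⟩ := exists_analyticAt_eventuallyEq_qc_of_ne hε hA1 hS hur q qc hqcq hPcd hqa A hA hsrc hz₀ hz₁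
  exact eq_zero_of_tendsto_sub_mul_of_eventuallyEq_analyticAt hg hfg hρ

/-- **NO RESIDUE AT ALL WHEN `χ₀ ≠ 1`**: under ★ J2's hypotheses with `ε ≠ 1`, every residue-limit on `½ < Re` vanishes, `z₀ = 1` included (★ `exists_analyticAt_eventuallyEq_qc_of_ne_one` + §1).
[cite: Rogawski1990, §13.9 (i) p. 229] [cite: MoeglinWaldspurger1995, IV.1.11] -/
theorem residue_eq_zero_of_char_ne_one (hε : ε.IsUnitary) (hA1 : ∀ t : ℝ≥0ˣ, ε (posRealIdele F t) = 1) (h1 : ε ≠ 1) (hS : S.Finite)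
    (hur : ∀ v ∉ S, ε.IsUnramifiedAt v)
    (q qc : ℂ → ℂ) {P : Set ℂ} (hqcq : ∀ z : ℂ, 1 < z.re → qc z = q z) (hPcd : ∀ z₀ : ℂ, ∀ᶠ s in 𝓝[≠] z₀, s ∉ P) (hqa : ∀ z : ℂ, z ∉ P → AnalyticAt ℂ qc z)
    (A : ℂ → ℂ) (hA : DifferentiableOn ℂ A {z : ℂ | 1 / 2 < z.re})
    (hsrc : ∀ z : ℂ, 1 < z.re →
      q z = A z * (partialStandardL S (fun v => {ε.valueAtUniformizer v}) (2 * z - 1) / partialStandardL S (fun v => {ε.valueAtUniformizer v}) (2 * z)))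
    {z₀ : ℂ} (hz₀ : 1 / 2 < z₀.re) {ρ : ℂ} (hρ : Tendsto (fun z : ℂ => (z - z₀) * qc z) (𝓝[≠] z₀) (𝓝 ρ)) : ρ = 0 := by
  obtain ⟨g, hg, hfg⟩ := exists_analyticAt_eventuallyEq_qc_of_ne_one hε hA1 h1 hS hur q qc hqcq hPcd hqa A hA hsrc hz₀
  exact eq_zero_of_tendsto_sub_mul_of_eventuallyEq_analyticAt hg hfg hρ

/-- **THE POLE DICHOTOMY**: under ★ J2's hypotheses, a NON-ZERO residue-limit `(z − z₀)·qc z → ρ ≠ 0` at a point `½ < Re z₀` forces `z₀ = 1` AND `ε = 1` («a top-pole residue atom ⇒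
`χ₀ = 1`»; «for `χ₀ ≠ 1` the `χ`-Eisenstein series of `U(1,1)` contributes nothing to the residual spectrum»). [cite: Rogawski1990, §13.9 (i) p. 229] [cite: MoeglinWaldspurger1995, IV.1.11] -/
theorem eq_one_and_char_eq_one_of_residue_ne_zero (hε : ε.IsUnitary) (hA1 : ∀ t : ℝ≥0ˣ, ε (posRealIdele F t) = 1) (hS : S.Finite)
    (hur : ∀ v ∉ S, ε.IsUnramifiedAt v)
    (q qc : ℂ → ℂ) {P : Set ℂ} (hqcq : ∀ z : ℂ, 1 < z.re → qc z = q z) (hPcd : ∀ z₀ : ℂ, ∀ᶠ s in 𝓝[≠] z₀, s ∉ P) (hqa : ∀ z : ℂ, z ∉ P → AnalyticAt ℂ qc z)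
    (A : ℂ → ℂ) (hA : DifferentiableOn ℂ A {z : ℂ | 1 / 2 < z.re})
    (hsrc : ∀ z : ℂ, 1 < z.re →
      q z = A z * (partialStandardL S (fun v => {ε.valueAtUniformizer v}) (2 * z - 1) / partialStandardL S (fun v => {ε.valueAtUniformizer v}) (2 * z)))
    {z₀ : ℂ} (hz₀ : 1 / 2 < z₀.re) {ρ : ℂ} (hρ : Tendsto (fun z : ℂ => (z - z₀) * qc z) (𝓝[≠] z₀) (𝓝 ρ)) (hρ0 : ρ ≠ 0) :
    z₀ = 1 ∧ ε = 1 := by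
  by_contra h
  rw [not_and_or] at h
  rcases h with hz₁ | h1
  · exact hρ0 (residue_eq_zero_of_ne_one hε hA1 hS hur q qc hqcq hPcd hqa A hA hsrc hz₀ hz₁ hρ)
  · exact hρ0 (residue_eq_zero_of_char_ne_one hε hA1 h1 hS hur q qc hqcq hPcd hqa A hA hsrc hz₀ hρ)

/-- **THE RESIDUE AT THE TOP POLE**: under ★ J2's hypotheses any residue-limit `(z − 1)·qc z → ρ` IS `A(1)·G(1)` for the ★ continuation `G` of `(z−1)·L^S(2z−1,ε)∕L^S(2z,ε)` (`G 1 ≠ 0 ⟺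
ε = 1`); in particular `ρ ≠ 0 ⟺ (ε = 1 ∧ A 1 ≠ 0)`. [cite: MoeglinWaldspurger1995, IV.1.11] [cite: Langlands1976, §7] -/
theorem residue_at_one_eq (hε : ε.IsUnitary) (hA1 : ∀ t : ℝ≥0ˣ, ε (posRealIdele F t) = 1) (hS : S.Finite) (hur : ∀ v ∉ S, ε.IsUnramifiedAt v)
    (q qc : ℂ → ℂ) {P : Set ℂ} (hqcq : ∀ z : ℂ, 1 < z.re → qc z = q z) (hPcd : ∀ z₀ : ℂ, ∀ᶠ s in 𝓝[≠] z₀, s ∉ P) (hqa : ∀ z : ℂ, z ∉ P → AnalyticAt ℂ qc z)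
    (A : ℂ → ℂ) (hA : DifferentiableOn ℂ A {z : ℂ | 1 / 2 < z.re})
    (hsrc : ∀ z : ℂ, 1 < z.re →
      q z = A z * (partialStandardL S (fun v => {ε.valueAtUniformizer v}) (2 * z - 1) / partialStandardL S (fun v => {ε.valueAtUniformizer v}) (2 * z)))
    {ρ : ℂ} (hρ : Tendsto (fun z : ℂ => (z - 1) * qc z) (𝓝[≠] 1) (𝓝 ρ)) :
    ∃ G : ℂ → ℂ, DifferentiableOn ℂ G {z : ℂ | 1 / 2 < z.re} ∧ (G 1 ≠ 0 ↔ ε = 1) ∧ ρ = A 1 * G 1 ∧ (ρ ≠ 0 ↔ ε = 1 ∧ A 1 ≠ 0) := by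
  obtain ⟨G, hG, hG1, hlim⟩ := tendsto_sub_one_mul_qc hε hA1 hS hur q qc hqcq hPcd hqa A hA hsrc
  have hρeq : ρ = A 1 * G 1 := tendsto_nhds_unique hρ hlim
  refine ⟨G, hG, hG1, hρeq, ?_⟩
  rw [hρeq, mul_ne_zero_iff, ← hG1]
  exact ⟨fun h => ⟨h.2, h.1⟩, fun h => ⟨h.2, h.1⟩⟩

/-! ## §3 The print in the pole currency of the self-dual block package (★ p860865: `Sp : Finset ℝ`, `ρ : ℝ → ℂ`, `hr`) -/

/-- **EVERY WEIGHTED POLE OF THE SELF-DUAL BLOCK IS THE TOP POLE, AND IT FORCES `χ₀ = 1`**: with the pole letters of ★ `exists_linearIsometry_chiSection_selfDual_m1_cm_two` read at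
`s := qc` (`Sp ⊂ (½, σ₀)` finite, `hr : (z − c)·qc z → ρ c` at each `c ∈ Sp`) and ★ J2's hypotheses: `∀ c ∈ Sp, ρ c ≠ 0 → c = 1 ∧ ε = 1` — the residue atoms of non-zero weight of a
self-dual `χ`-block all sit at `z = 1` and exist only if `χ₀ = 1`. [cite: Rogawski1990, §13.9 (i) p. 229] [cite: MoeglinWaldspurger1995, IV.1.11] -/
theorem forall_poles_eq_one_and_char_eq_one (hε : ε.IsUnitary) (hA1 : ∀ t : ℝ≥0ˣ, ε (posRealIdele F t) = 1) (hS : S.Finite) (hur : ∀ v ∉ S, ε.IsUnramifiedAt v)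
    (q qc : ℂ → ℂ) {P : Set ℂ} (hqcq : ∀ z : ℂ, 1 < z.re → qc z = q z) (hPcd : ∀ z₀ : ℂ, ∀ᶠ s in 𝓝[≠] z₀, s ∉ P) (hqa : ∀ z : ℂ, z ∉ P → AnalyticAt ℂ qc z)
    (A : ℂ → ℂ) (hA : DifferentiableOn ℂ A {z : ℂ | 1 / 2 < z.re})
    (hsrc : ∀ z : ℂ, 1 < z.re →
      q z = A z * (partialStandardL S (fun v => {ε.valueAtUniformizer v}) (2 * z - 1) / partialStandardL S (fun v => {ε.valueAtUniformizer v}) (2 * z)))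
    {σ₀ : ℝ} (Sp : Finset ℝ) (hSp : ∀ c ∈ Sp, 1 / 2 < c ∧ c < σ₀) (ρ : ℝ → ℂ)
    (hr : ∀ c ∈ Sp, Tendsto (fun z : ℂ => (z - c) * qc z) (𝓝[≠] (c : ℂ)) (𝓝 (ρ c))) :
    ∀ c ∈ Sp, ρ c ≠ 0 → c = 1 ∧ ε = 1 := by
  intro c hc hρ0
  have hz₀ : 1 / 2 < ((c : ℂ)).re := by rw [Complex.ofReal_re]; exact (hSp c hc).1
  obtain ⟨h1, hε1⟩ := eq_one_and_char_eq_one_of_residue_ne_zero hε hA1 hS hur q qc hqcq hPcd hqa A hA hsrc hz₀ (hr c hc) hρ0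
  exact ⟨by exact_mod_cast h1, hε1⟩

/-- **… so if `χ₀ ≠ 1` the block carries NO weighted pole: `∀ c ∈ Sp, ρ c = 0`** (the self-dual `χ`-family with `χ₀ ≠ 1` has no residue atom).
[cite: Rogawski1990, §13.9 (i) p. 229] [cite: MoeglinWaldspurger1995, IV.1.11] -/
theorem forall_poles_residue_eq_zero_of_char_ne_one (hε : ε.IsUnitary) (hA1 : ∀ t : ℝ≥0ˣ, ε (posRealIdele F t) = 1) (h1 : ε ≠ 1) (hS : S.Finite)
    (hur : ∀ v ∉ S, ε.IsUnramifiedAt v)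
    (q qc : ℂ → ℂ) {P : Set ℂ} (hqcq : ∀ z : ℂ, 1 < z.re → qc z = q z) (hPcd : ∀ z₀ : ℂ, ∀ᶠ s in 𝓝[≠] z₀, s ∉ P) (hqa : ∀ z : ℂ, z ∉ P → AnalyticAt ℂ qc z)
    (A : ℂ → ℂ) (hA : DifferentiableOn ℂ A {z : ℂ | 1 / 2 < z.re})
    (hsrc : ∀ z : ℂ, 1 < z.re →
      q z = A z * (partialStandardL S (fun v => {ε.valueAtUniformizer v}) (2 * z - 1) / partialStandardL S (fun v => {ε.valueAtUniformizer v}) (2 * z)))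
    {σ₀ : ℝ} (Sp : Finset ℝ) (hSp : ∀ c ∈ Sp, 1 / 2 < c ∧ c < σ₀) (ρ : ℝ → ℂ)
    (hr : ∀ c ∈ Sp, Tendsto (fun z : ℂ => (z - c) * qc z) (𝓝[≠] (c : ℂ)) (𝓝 (ρ c))) :
    ∀ c ∈ Sp, ρ c = 0 := fun c hc =>
  residue_eq_zero_of_char_ne_one hε hA1 h1 hS hur q qc hqcq hPcd hqa A hA hsrc (by rw [Complex.ofReal_re]; exact (hSp c hc).1) (hr c hc)

end Scattering

/-! ## §4 The CM print `F = L⁺` -/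

section CM

variable (L : Type) [Field L] [NumberField L]

/-- **THE CM PRINT (`U(1,1)_{L∕L⁺}`)**: for `ε = χ₀` on `𝔸_{L⁺}^×` and one coordinate `(q, qc, P)` of a continued `χ`-scattering package with the one-source letter `hsrc`: a non-zero
residue-limit of `qc` at `½ < Re z₀` forces `z₀ = 1 ∧ χ₀ = 1`. [cite: Rogawski1990, §13.9 (i) p. 229] [cite: MoeglinWaldspurger1995, IV.1.11] -/
theorem eq_one_and_char_eq_one_of_residue_ne_zero_cm {ε : HeckeCharacter ↥(maximalRealSubfield L)} {S : Set (HeightOneSpectrum (𝓞 ↥(maximalRealSubfield L)))}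
    (hε : ε.IsUnitary) (hA1 : ∀ t : ℝ≥0ˣ, ε (posRealIdele ↥(maximalRealSubfield L) t) = 1) (hS : S.Finite) (hur : ∀ v ∉ S, ε.IsUnramifiedAt v)
    (q qc : ℂ → ℂ) {P : Set ℂ} (hqcq : ∀ z : ℂ, 1 < z.re → qc z = q z) (hPcd : ∀ z₀ : ℂ, ∀ᶠ s in 𝓝[≠] z₀, s ∉ P) (hqa : ∀ z : ℂ, z ∉ P → AnalyticAt ℂ qc z)
    (A : ℂ → ℂ) (hA : DifferentiableOn ℂ A {z : ℂ | 1 / 2 < z.re})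
    (hsrc : ∀ z : ℂ, 1 < z.re →
      q z = A z * (partialStandardL S (fun v => {ε.valueAtUniformizer v}) (2 * z - 1) / partialStandardL S (fun v => {ε.valueAtUniformizer v}) (2 * z)))
    {z₀ : ℂ} (hz₀ : 1 / 2 < z₀.re) {ρ : ℂ} (hρ : Tendsto (fun z : ℂ => (z - z₀) * qc z) (𝓝[≠] z₀) (𝓝 ρ)) (hρ0 : ρ ≠ 0) :
    z₀ = 1 ∧ ε = 1 :=
  eq_one_and_char_eq_one_of_residue_ne_zero hε hA1 hS hur q qc hqcq hPcd hqa A hA hsrc hz₀ hρ hρ0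

end CM

end Summit.HodgeConjecture.HodgeConjecture.Cruxes.H413.K2E1ChiScatteringPoleDichotomyU2

end
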